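import Summits.Ventures.YMGap.RobustBall.TorusAxisColumn
import HarnessLib

/-!
# Robust ball (Y2) — the TARGET ROW of the axis column for the robust torus Dobrushin matrix (input of the sharp form `TorusAxisSharp`)

HONEST FRAMING: venture file of the cell `pub-ymgap` (QuantumFields programme), track ROBUST-BALL, seat rb-p2 (g11).  Strong-coupling LATTICE bookkeeping on finite tori
`(ℤ/L)^d` (no measure theory): the modulus `K` and the coupling enter only through the coefficient `A(x) = K e^{a(x)}(1 + 2√N ℓ_s(x))|β|/N` of ds-2's robust torus door
(`TorusDoor`); nothing continuum / Clay.
CONTENT.  Föllmer's pairwise estimate needs a margin only AT THE TARGET `x = y` (`ZdPairwiseColumn.abs_covariance_le_pairwise_of_target`), and there the cycle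
eigenvector `g` of `TorusAxisCycle` has slack: along the axis of the target link itself the staple offsets are `{+1, 0, −1}` per plaquette and `g(±1) ≤ 2θ`, `g ≤ 2`,
`g(0) ≥ 1`.  `sum_profile_plaqsThrough_le_of_ratio` — the RATIO form (at one point `K = H_i(e)`: `G(K±1) ≤ ρ₁G(K)`, `G(K±2) ≤ ρ₂G(K)`) of
`TorusAxisProfile.sum_profile_plaqsThrough_le`: `Σ_{q ∋ e} Σ_k G(H_i staple) ≤ 2(d−1)(2ρ₁+1)·G(K)` (`μ = i`) resp. `(2ρ₂+4ρ₁+6(d−2))·G(K)`;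
`column_target_axis_le` — the member's TARGET ROW along the target link's own axis: `Σ_{z ∈ nbr y} C_W(y,z) g(H_i z − H_i y) ≤ (A·2(d−1)(4θ+1) + 2√N ε₁)·g(0)`.

References: H. Föllmer, LNM 1362 (1988), Ch. I; the tree: `TorusAxisProfile`, `TorusAxisCycle`, `TorusAxisColumn` (this seat), `TorusDoor` (ds-2).
-/

noncomputable section

open MeasureTheory ProbabilityTheory Finset Function Real
open Literature.Probability.LatticeModels Literature.Probability.LatticeModels.DobrushinMetric
open Literature.MathematicalPhysics.QuantumLattice hiding torusNorm
open Literature.MathematicalPhysics.QuantumFieldTheory hiding ZdEdge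
open Literature.MathematicalPhysics.QuantumFieldTheory.Balaban1983to89.StrongCouplingTorusWindow
open Literature.MathematicalPhysics.QuantumFieldTheory.Balaban1983to89.StrongCouplingDobrushinWindow (OneLinkKRModulus)

namespace Summit.Ventures.YMGap.RobustBall.TorusAxis

variable {d L N : ℕ} [NeZero L]

/-! ### The torus axis offset bound in RATIO form (for the target row) -/

/-- **THE TORUS AXIS OFFSET BOUND, RATIO FORM AT ONE POINT.**  `d ≥ 2`, `L ≥ 2`, a link `e = (x, μ)`, an axis `i`, a profile `G ≥ 0` on `ℤ/2L` and the point
`K = H_i(e)` with `G(K±1) ≤ ρ₁ G(K)`, `G(K±2) ≤ ρ₂ G(K)`: `∑_{q ∋ e} ∑_k G(H_i(staple_k(q))) ≤ P·G(K)` with `P = 2(d−1)(2ρ₁+1)` if `μ = i` and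
`2ρ₂ + 4ρ₁ + 6(d−2)` if `μ ≠ i`. [folklore] -/
theorem sum_profile_plaqsThrough_le_of_ratio (hd : 2 ≤ d) (hL : 2 ≤ L) {ρ₁ ρ₂ : ℝ}
    {G : ZMod (2 * L) → ℝ} (hG0 : ∀ k, 0 ≤ G k) (e : Edge d L) (i : Fin d)
    (hu1 : G (((2 * (e.1 i).val : ℕ) : ZMod (2 * L)) + (if e.2 = i then 1 else 0) + 1) ≤
      ρ₁ * G (((2 * (e.1 i).val : ℕ) : ZMod (2 * L)) + (if e.2 = i then 1 else 0)))
    (hd1' : G (((2 * (e.1 i).val : ℕ) : ZMod (2 * L)) + (if e.2 = i then 1 else 0) - 1) ≤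
      ρ₁ * G (((2 * (e.1 i).val : ℕ) : ZMod (2 * L)) + (if e.2 = i then 1 else 0)))
    (hu2 : G (((2 * (e.1 i).val : ℕ) : ZMod (2 * L)) + (if e.2 = i then 1 else 0) + 2) ≤
      ρ₂ * G (((2 * (e.1 i).val : ℕ) : ZMod (2 * L)) + (if e.2 = i then 1 else 0)))
    (hd2' : G (((2 * (e.1 i).val : ℕ) : ZMod (2 * L)) + (if e.2 = i then 1 else 0) - 2) ≤
      ρ₂ * G (((2 * (e.1 i).val : ℕ) : ZMod (2 * L)) + (if e.2 = i then 1 else 0))) :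
    ∑ q ∈ plaqsThrough e, ∑ k : Fin 3,
        G (((2 * ((tstapleLinks q e k).1 i).val : ℕ) : ZMod (2 * L)) + (if (tstapleLinks q e k).2 = i then 1 else 0)) ≤
      (if e.2 = i then 2 * ((d - 1 : ℕ) : ℝ) * (2 * ρ₁ + 1) else 2 * ρ₂ + 4 * ρ₁ + 6 * ((d - 2 : ℕ) : ℝ)) *
        G (((2 * (e.1 i).val : ℕ) : ZMod (2 * L)) + (if e.2 = i then 1 else 0)) := by
  classical
  set K : ZMod (2 * L) := ((2 * (e.1 i).val : ℕ) : ZMod (2 * L)) + (if e.2 = i then 1 else 0) with hK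
  -- the per-plaquette value as a function of (other direction, side)
  set T' : Fin d × Bool → ℝ := fun p =>
    if e.2 = i then G (K + 1) + G K + G (K - 1)
    else if p.1 = i then (if p.2 then 2 * G (K + 1) + G (K + 2) else 2 * G (K - 1) + G (K - 2)) else 3 * G K with hT'
  have hT'0 : ∀ p, 0 ≤ T' p := by
    intro p; simp only [hT']
    have := hG0 (K + 1); have := hG0 K; have := hG0 (K - 1); have := hG0 (K + 2); have := hG0 (K - 2)
    split_ifs <;> linarith
  set gq : Plaquette d L → Fin d × Bool := fun q => ((if q.2.1.1 = e.2 then q.2.1.2 else q.2.1.1), decide (q.1 = e.1)) with hgq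
  have hterm : ∀ q ∈ plaqsThrough e, ∑ k : Fin 3,
      G (((2 * ((tstapleLinks q e k).1 i).val : ℕ) : ZMod (2 * L)) + (if (tstapleLinks q e k).2 = i then 1 else 0)) = T' (gq q) := by
    intro q hq
    rw [sum_profile_tstapleLinks_eq hL G q (mem_plaqsThrough.1 hq) i]
    simp only [hT', hgq, hK, decide_eq_true_eq]
  rw [Finset.sum_congr rfl hterm]
  have hinj : Set.InjOn gq ↑(plaqsThrough e) := by
    intro q hq q' hq' h
    simp only [hgq, Prod.mk.injEq] at h
    exact plaq_eq_of_otherDir_side (mem_plaqsThrough.1 (Finset.mem_coe.1 hq)) (mem_plaqsThrough.1 (Finset.mem_coe.1 hq')) h.1 h.2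
  have hmaps : (plaqsThrough e).image gq ⊆ (Finset.univ.erase e.2) ×ˢ (Finset.univ : Finset Bool) := by
    intro p hp
    obtain ⟨q, hq, rfl⟩ := Finset.mem_image.1 hp
    exact Finset.mem_product.2 ⟨Finset.mem_erase.2 ⟨otherDir_ne (mem_plaqsThrough.1 hq), Finset.mem_univ _⟩, Finset.mem_univ _⟩
  have hGK := hG0 K
  calc ∑ q ∈ plaqsThrough e, T' (gq q)
      = ∑ p ∈ (plaqsThrough e).image gq, T' p := (Finset.sum_image hinj).symm
    _ ≤ ∑ p ∈ (Finset.univ.erase e.2) ×ˢ (Finset.univ : Finset Bool), T' p :=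
        Finset.sum_le_sum_of_subset_of_nonneg hmaps fun p _ _ => hT'0 p
    _ ≤ _ := by
        by_cases hμ : e.2 = i
        · simp only [hT', hμ, if_true, Finset.sum_const, Finset.card_product, Finset.card_erase_of_mem (Finset.mem_univ _),
            Finset.card_univ, Fintype.card_fin, Fintype.card_bool, nsmul_eq_mul]
          push_cast [Nat.cast_sub (by omega : 1 ≤ d)]
          have hd2 : (2 : ℝ) ≤ d := by exact_mod_cast hd
          have hd0 : (0 : ℝ) ≤ (d : ℝ) - 1 := by linarith
          have h3 : G (K + 1) + G K + G (K - 1) ≤ (2 * ρ₁ + 1) * G K := by linarith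
          nlinarith [mul_le_mul_of_nonneg_left h3 hd0]
        · rw [Finset.sum_product]
          have hi : i ∈ Finset.univ.erase e.2 := Finset.mem_erase.2 ⟨Ne.symm hμ, Finset.mem_univ _⟩
          rw [← Finset.add_sum_erase _ _ hi]
          have hfirst : ∑ b : Bool, T' (i, b) = 2 * (G (K + 1) + G (K - 1)) + (G (K + 2) + G (K - 2)) := by
            simp [hT', hμ]; ring
          have hrest : ∀ ν ∈ (Finset.univ.erase e.2).erase i, ∑ b : Bool, T' (ν, b) = 6 * G K := by
            intro ν hν
            have hνi : ν ≠ i := (Finset.mem_erase.1 hν).1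
            simp [hT', hμ, hνi]; ring
          have hcard : ((Finset.univ.erase e.2).erase i).card = d - 2 := by
            rw [Finset.card_erase_of_mem hi, Finset.card_erase_of_mem (Finset.mem_univ _), Finset.card_univ, Fintype.card_fin]
            omega
          rw [hfirst, Finset.sum_congr rfl hrest, Finset.sum_const, nsmul_eq_mul, hcard, if_neg hμ]
          nlinarith

/-! ### The target row of the member's Dobrushin matrix along the target link's own axis -/

/-- **THE TARGET ROW (member, torus).**  For a member with witness `w` (`a ≤ ε₀`, `ℓ_s + Λ ≤ ε₁` per link), a link `y` with axis `i = dir y`, and a profile `g > 0`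
on `ℤ/2L` with `g(0) ≥ 1`, `g ≤ 2`, `g(±1) ≤ 2θ`: the target row of the column `z ↦ g(H_i z − H_i y)` is
`Σ_{z ∈ nbr y} C_W(y,z) g(H_i z − H_i y) ≤ (K e^{ε₀}(1+2√Nε₁)(|β|/N)·2(d−1)(4θ+1) + 2√N ε₁)·g(0)`. [folklore] -/
theorem column_target_axis_le (hd : 2 ≤ d) (hL : 2 ≤ L) {β K ε₀ ε₁ θ : ℝ} {r : ℕ} (hK : 0 ≤ K) (hθ0 : 0 < θ)
    {W : Perturbation d L N} (w : LoadWitness W) (hwa : ∀ e, w.oscLoad 0 e ≤ ε₀)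
    (hwℓ : ∀ e, w.selfLipLoad 0 e + w.crossLipLoad 0 e ≤ ε₁)
    {g : ZMod (2 * L) → ℝ} (hg0 : ∀ k, 0 < g k) (hg00 : 1 ≤ g 0) (hg2 : ∀ k, g k ≤ 2) (hgp1 : g 1 ≤ 2 * θ) (hgm1 : g (-1) ≤ 2 * θ)
    (y : Edge d L) :
    ∑ z ∈ (univ.erase y).filter (fun z => torusNorm (y.1 - z.1) ≤ max r 1),
        (K * Real.exp (w.oscLoad 0 y) * (1 + 2 * Real.sqrt N * w.selfLipLoad 0 y) * (|β| / N) * tInfluence y z +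
          Real.sqrt N * w.crossLip 0 y z) *
          g ((((2 * (z.1 y.2).val : ℕ) : ZMod (2 * L)) + (if z.2 = y.2 then 1 else 0)) -
            (((2 * (y.1 y.2).val : ℕ) : ZMod (2 * L)) + (if y.2 = y.2 then 1 else 0))) ≤
      (K * Real.exp ε₀ * (1 + 2 * Real.sqrt N * ε₁) * (|β| / N) * (2 * ((d : ℝ) - 1) * (4 * θ + 1)) + 2 * Real.sqrt N * ε₁) * g 0 := by
  set i : Fin d := y.2 with hi
  set c : ZMod (2 * L) := ((2 * (y.1 i).val : ℕ) : ZMod (2 * L)) + (if y.2 = i then 1 else 0) with hc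
  set nbr := (univ.erase y).filter (fun z => torusNorm (y.1 - z.1) ≤ max r 1) with hnbr
  set G : ZMod (2 * L) → ℝ := fun k => g (k - c) with hG
  set A : ℝ := K * Real.exp (w.oscLoad 0 y) * (1 + 2 * Real.sqrt N * w.selfLipLoad 0 y) * (|β| / N) with hA
  set u : Edge d L → ℝ := fun z => G (((2 * (z.1 i).val : ℕ) : ZMod (2 * L)) + (if z.2 = i then 1 else 0)) with hu
  change ∑ z ∈ nbr, (A * tInfluence y z + Real.sqrt N * w.crossLip 0 y z) * u z ≤ _
  have hG0 : ∀ k, 0 ≤ G k := fun k => (hg0 _).le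
  have hu0 : ∀ z, 0 ≤ u z := fun z => hG0 _
  have hu2' : ∀ z, u z ≤ 2 := fun z => hg2 _
  have hGc : G c = g 0 := by simp [hG]
  have hg0' : 0 < g 0 := hg0 0
  -- ratios at the target point
  have hu1 : G (c + 1) ≤ (2 * θ) * G c := by
    rw [hGc]; simp only [hG, add_sub_cancel_left]; nlinarith
  have hd1' : G (c - 1) ≤ (2 * θ) * G c := by
    rw [hGc]; simp only [hG, sub_sub_cancel_left]; nlinarith
  have hu2 : G (c + 2) ≤ 2 * G c := by
    rw [hGc]; simp only [hG, add_sub_cancel_left]; nlinarith [hg2 2]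
  have hd2' : G (c - 2) ≤ 2 * G c := by
    rw [hGc]; simp only [hG, sub_sub_cancel_left]; nlinarith [hg2 (-2)]
  -- Wilson part: `Σ_T n(y,z) G(H z) ≤ Σ_{q ∋ y} Σ_k G(H staple) ≤ 2(d−1)(4θ+1) G(c)`
  have hyi : y.2 = i := rfl
  have hW1 : ∑ z ∈ nbr, (tInfluence y z : ℝ) * u z ≤ ∑ q ∈ plaqsThrough y, ∑ k : Fin 3, u (tstapleLinks q y k) := by
    classical
    unfold tInfluence
    push_cast
    simp only [Finset.sum_mul]
    rw [Finset.sum_comm]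
    refine Finset.sum_le_sum fun q _ => ?_
    rw [Finset.sum_comm]
    refine Finset.sum_le_sum fun k _ => ?_
    rw [show ∑ z ∈ nbr, (if tstapleLinks q y k = z then (1 : ℝ) else 0) * u z =
      ∑ z ∈ nbr, (if tstapleLinks q y k = z then u z else 0) from Finset.sum_congr rfl fun z _ => by split_ifs <;> simp,
      Finset.sum_ite_eq]
    split_ifs
    · exact le_rfl
    · exact hu0 _
  have hW2 := sum_profile_plaqsThrough_le_of_ratio hd hL (ρ₁ := 2 * θ) (ρ₂ := 2) hG0 y i
    (by rw [← hc]; exact hu1) (by rw [← hc]; exact hd1') (by rw [← hc]; exact hu2) (by rw [← hc]; exact hd2')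
  rw [if_pos hyi, ← hc] at hW2
  have hdm1 : ((d - 1 : ℕ) : ℝ) = (d : ℝ) - 1 := by rw [Nat.cast_sub (by omega)]; simp
  rw [hdm1] at hW2
  have hW : ∑ z ∈ nbr, (tInfluence y z : ℝ) * u z ≤ 2 * ((d : ℝ) - 1) * (2 * (2 * θ) + 1) * G c := hW1.trans hW2
  -- cross part: `G ≤ 2`
  have hcross : ∑ z ∈ nbr, w.crossLip 0 y z * u z ≤ w.crossLipLoad 0 y * 2 := by
    calc ∑ z ∈ nbr, w.crossLip 0 y z * u z
        ≤ ∑ z ∈ nbr, w.crossLip 0 y z * 2 := Finset.sum_le_sum fun z _ => mul_le_mul_of_nonneg_left (hu2' _) (crossLip_nonneg w 0 y z)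
      _ = (∑ z ∈ nbr, w.crossLip 0 y z) * 2 := (Finset.sum_mul _ _ _).symm
      _ ≤ w.crossLipLoad 0 y * 2 := by
          refine mul_le_mul_of_nonneg_right ?_ zero_le_two
          exact Finset.sum_le_sum_of_subset_of_nonneg (Finset.filter_subset _ _) fun z _ _ => crossLip_nonneg w 0 y z
  -- loads at `y`
  have hA0 : 0 ≤ A := by
    simp only [hA]
    exact mul_nonneg (mul_nonneg (mul_nonneg hK (Real.exp_pos _).le)
      (add_nonneg zero_le_one (mul_nonneg (by positivity) (selfLipLoad_nonneg w 0 y)))) (by positivity)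
  have hℓs : w.selfLipLoad 0 y ≤ ε₁ := by linarith [hwℓ y, crossLipLoad_nonneg w 0 y]
  have hΛ : w.crossLipLoad 0 y ≤ ε₁ := by linarith [hwℓ y, selfLipLoad_nonneg w 0 y]
  have hAle : A ≤ K * Real.exp ε₀ * (1 + 2 * Real.sqrt N * ε₁) * (|β| / N) := by
    simp only [hA]
    have h1 : Real.exp (w.oscLoad 0 y) ≤ Real.exp ε₀ := Real.exp_le_exp.2 (hwa y)
    have h2 : 1 + 2 * Real.sqrt N * w.selfLipLoad 0 y ≤ 1 + 2 * Real.sqrt N * ε₁ := by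
      have := mul_le_mul_of_nonneg_left hℓs (show 0 ≤ 2 * Real.sqrt N by positivity); linarith
    have h3 : 0 ≤ 1 + 2 * Real.sqrt N * w.selfLipLoad 0 y :=
      add_nonneg zero_le_one (mul_nonneg (by positivity) (selfLipLoad_nonneg w 0 y))
    calc K * Real.exp (w.oscLoad 0 y) * (1 + 2 * Real.sqrt N * w.selfLipLoad 0 y) * (|β| / N)
        ≤ K * Real.exp ε₀ * (1 + 2 * Real.sqrt N * w.selfLipLoad 0 y) * (|β| / N) := by gcongr
      _ ≤ K * Real.exp ε₀ * (1 + 2 * Real.sqrt N * ε₁) * (|β| / N) := by gcongr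
  have hd2 : (2 : ℝ) ≤ d := by exact_mod_cast hd
  have hP0 : 0 ≤ 2 * ((d : ℝ) - 1) * (4 * θ + 1) := mul_nonneg (mul_nonneg zero_le_two (by linarith)) (by positivity)
  -- assemble
  have hsplit : ∑ z ∈ nbr, (A * tInfluence y z + Real.sqrt N * w.crossLip 0 y z) * u z =
      A * ∑ z ∈ nbr, (tInfluence y z : ℝ) * u z + Real.sqrt N * ∑ z ∈ nbr, w.crossLip 0 y z * u z := by
    rw [Finset.mul_sum, Finset.mul_sum, ← Finset.sum_add_distrib]
    exact Finset.sum_congr rfl fun z _ => by ring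
  rw [hsplit]
  calc A * ∑ z ∈ nbr, (tInfluence y z : ℝ) * u z + Real.sqrt N * ∑ z ∈ nbr, w.crossLip 0 y z * u z
      ≤ A * (2 * ((d : ℝ) - 1) * (2 * (2 * θ) + 1) * G c) + Real.sqrt N * (w.crossLipLoad 0 y * 2) :=
        add_le_add (mul_le_mul_of_nonneg_left hW hA0) (mul_le_mul_of_nonneg_left hcross (Real.sqrt_nonneg _))
    _ ≤ K * Real.exp ε₀ * (1 + 2 * Real.sqrt N * ε₁) * (|β| / N) * (2 * ((d : ℝ) - 1) * (4 * θ + 1) * G c) +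
        Real.sqrt N * (ε₁ * 2) := by
        have e1 : 2 * ((d : ℝ) - 1) * (2 * (2 * θ) + 1) * G c = 2 * ((d : ℝ) - 1) * (4 * θ + 1) * G c := by ring
        rw [e1]
        exact add_le_add (mul_le_mul_of_nonneg_right hAle (mul_nonneg hP0 (hG0 c)))
          (mul_le_mul_of_nonneg_left (mul_le_mul_of_nonneg_right hΛ zero_le_two) (Real.sqrt_nonneg _))
    _ ≤ (K * Real.exp ε₀ * (1 + 2 * Real.sqrt N * ε₁) * (|β| / N) * (2 * ((d : ℝ) - 1) * (4 * θ + 1)) + 2 * Real.sqrt N * ε₁) * g 0 := by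
        rw [hGc]
        have hε₁ : 0 ≤ ε₁ := (selfLipLoad_nonneg w 0 y).trans hℓs
        have : Real.sqrt N * (ε₁ * 2) ≤ 2 * Real.sqrt N * ε₁ * g 0 := by
          have h0 : 0 ≤ 2 * Real.sqrt N * ε₁ := by positivity
          nlinarith
        nlinarith [mul_nonneg (hA0.trans hAle) hP0, hg0']

end Summit.Ventures.YMGap.RobustBall.TorusAxis

end
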